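import Mathlib

/-!
# Square complexes on vertex set `ℕ` — oriented edges and squares (negative-side helpers)

Negative-side support for crux `stmt-QuantumFields-15827`
(`Summit.QuantumFields.YangMills.Theses.HyperbolicRegulator.HyperbolicToTorus`) and for the shared
`let Fam := …` vocabulary of route `HyperbolicRegulator` (`CurvatureAnchor`, `CurvatureUniformity`,
`HyperbolicToTorus`). Nothing here asserts a Theses statement; everything is finite combinatorics.

Vocabulary, matching the route's lets: edge ids `e ∈ E : Finset ℕ` with source `σ e` and target `τ e`;
flagged edges `(e, b) : ℕ × Bool` with start `st` and end `en` — ANY pair of functions with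
`{st (e,b), en (e,b)} = {σ e, τ e}` (the route: `st (e,b) = if b then σ e else τ e`, `en` the other); squares
`q` with boundary `bd q : Fin 4 → ℕ × Bool`, edges in `E`, consecutive (`en (bd q i) = st (bd q (i+1))`),
injective vertex cycle `st ∘ bd q` (route axiom 2); every edge in exactly two squares (route axiom 3).

* `exists_second_edge_at` — a square through an edge `f` with endpoint `v` has a second, different edge
  with endpoint `v`.
* `false_of_three_squares` — under axiom 3, three pairwise distinct squares never share an edge.

Consumed by `Negative/InteriorChartDegree.lean` (a chart interior never contains a cone).
-/

namespace Summit.QuantumFields.YangMills.Theorems.HyperbolicToTorus.Negative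

open Finset

/-! ### Endpoint pairs -/

section Pairs

/-- Membership in the endpoint pair `{σ e, τ e}`, in the orientation of the route's degree count
`σ e = v ∨ τ e = v`. [folklore] -/
theorem mem_endpair_iff {σ τ : ℕ → ℕ} {e v : ℕ} :
    v ∈ ({σ e, τ e} : Finset ℕ) ↔ (σ e = v ∨ τ e = v) := by
  simp only [mem_insert, mem_singleton]
  constructor <;> rintro (h | h) <;> simp [h]

/-- Two-element sets `{a, b} = {a, c}` with `b ≠ a` force `b = c`. [folklore] -/
theorem pair_eq_pair_left {a b c : ℕ} (hb : b ≠ a) (h : ({a, b} : Finset ℕ) = {a, c}) : b = c := by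
  have : b ∈ ({a, c} : Finset ℕ) := h ▸ (by simp)
  rcases mem_insert.1 this with h' | h'
  · exact absurd h' hb
  · simpa using h'

end Pairs

/-! ### One square: a square through an edge at `v` has a second, different edge at `v` -/

section Square

variable {σ τ : ℕ → ℕ} {st en : ℕ × Bool → ℕ} {E : Finset ℕ} {bd : Fin 4 → ℕ × Bool}

/-- In a square with boundary `bd` (edges in `E`, consecutive, injective vertex cycle), an edge `f` of
the square with endpoint `v` is accompanied by a DIFFERENT edge of the square, also in `E`, also with
endpoint `v` (the other boundary edge at the corner `v`). `st`/`en` are any start/end maps of flagged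
edges with `{st e, en e} = {σ e.1, τ e.1}`. [folklore] -/
theorem exists_second_edge_at (hpair : ∀ e : ℕ × Bool, ({st e, en e} : Finset ℕ) = {σ e.1, τ e.1})
    (hE : ∀ i, (bd i).1 ∈ E) (hcons : ∀ i, en (bd i) = st (bd (i + 1)))
    (hinj : Function.Injective (st ∘ bd)) {f v : ℕ} {i : Fin 4} (hf : (bd i).1 = f)
    (hv : v ∈ ({σ f, τ f} : Finset ℕ)) :
    ∃ i', (bd i').1 ≠ f ∧ (bd i').1 ∈ E ∧ v ∈ ({σ (bd i').1, τ (bd i').1} : Finset ℕ) := by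
  have hst_ne : ∀ j j' : Fin 4, j ≠ j' → st (bd j) ≠ st (bd j') := fun j j' hjj' h =>
    hjj' (hinj h)
  have hA : ∀ j : Fin 4, j + 3 + 1 = j := by decide
  have hB : ∀ j : Fin 4, j + 3 ≠ j := by decide
  have hC : ∀ j : Fin 4, j + 3 ≠ j + 1 := by decide
  have hD : ∀ j : Fin 4, j + 1 + 1 ≠ j := by decide
  have hD' : ∀ j : Fin 4, j + 1 + 1 ≠ j + 1 := by decide
  have st_mem : ∀ e : ℕ × Bool, st e ∈ ({σ e.1, τ e.1} : Finset ℕ) := fun e =>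
    hpair e ▸ mem_insert_self _ _
  have en_mem : ∀ e : ℕ × Bool, en e ∈ ({σ e.1, τ e.1} : Finset ℕ) := fun e =>
    hpair e ▸ mem_insert_of_mem (mem_singleton_self _)
  -- the previous slot ends where slot `i` starts
  have hprev : en (bd (i + 3)) = st (bd i) := by rw [hcons, hA]
  rw [← hf, ← hpair, mem_insert, mem_singleton] at hv
  rcases hv with hv | hv
  · -- `v` is the START of slot `i`: the previous slot `i + 3` ends at `v`.
    refine ⟨i + 3, ?_, hE _, ?_⟩
    · intro heq
      have hends : ({σ (bd (i + 3)).1, τ (bd (i + 3)).1} : Finset ℕ) = {σ (bd i).1, τ (bd i).1} := by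
        rw [heq, hf]
      have h2 : st (bd (i + 3)) ∈ ({σ (bd i).1, τ (bd i).1} : Finset ℕ) := hends ▸ st_mem _
      rw [← hpair, mem_insert, mem_singleton] at h2
      rcases h2 with h2 | h2
      · exact hst_ne (i + 3) i (hB i) h2
      · rw [hcons] at h2
        exact hst_ne (i + 3) (i + 1) (hC i) h2
    · rw [← hpair, hv, ← hprev]
      exact mem_insert_of_mem (mem_singleton_self _)
  · -- `v` is the END of slot `i`, i.e. the start of slot `i + 1`.
    refine ⟨i + 1, ?_, hE _, ?_⟩
    · intro heq
      have hends : ({σ (bd (i + 1)).1, τ (bd (i + 1)).1} : Finset ℕ) = {σ (bd i).1, τ (bd i).1} := by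
        rw [heq, hf]
      have h2 : en (bd (i + 1)) ∈ ({σ (bd i).1, τ (bd i).1} : Finset ℕ) := hends ▸ en_mem _
      rw [← hpair, mem_insert, mem_singleton] at h2
      rcases h2 with h2 | h2
      · rw [hcons] at h2
        exact hst_ne (i + 1 + 1) i (hD i) h2
      · rw [hcons, hcons] at h2
        exact hst_ne (i + 1 + 1) (i + 1) (hD' i) h2
    · rw [← hpair, hv, hcons i]
      exact mem_insert_self _ _

end Square

/-! ### Squares through an edge -/

section Squares

variable {E Q : Finset ℕ} {bd : ℕ → Fin 4 → ℕ × Bool}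

/-- The edge-id set of a square, `univ.image (Prod.fst ∘ bd q)` (the shape of the route's chart-square
axiom), contains `f` iff some boundary slot carries `f`. [folklore] -/
theorem mem_image_fst_bd {q f : ℕ} :
    f ∈ Finset.univ.image (Prod.fst ∘ bd q) ↔ ∃ i, (bd q i).1 = f := by
  simp [Finset.mem_image]

/-- If every edge lies in exactly two squares (route axiom 3), three pairwise distinct squares of `Q`
cannot share an edge. [folklore] -/
theorem false_of_three_squares (h3 : ∀ e ∈ E, (Q.filter fun q => ∃ i, (bd q i).1 = e).card = 2)
    {f : ℕ} (hf : f ∈ E) {qa qb qc : ℕ} (ha : qa ∈ Q) (hb : qb ∈ Q) (hc : qc ∈ Q)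
    (hfa : ∃ i, (bd qa i).1 = f) (hfb : ∃ i, (bd qb i).1 = f) (hfc : ∃ i, (bd qc i).1 = f)
    (hab : qa ≠ qb) (hac : qa ≠ qc) (hbc : qb ≠ qc) : False := by
  classical
  have hsub : ({qa, qb, qc} : Finset ℕ) ⊆ Q.filter fun q => ∃ i, (bd q i).1 = f := by
    intro q hq
    simp only [mem_insert, mem_singleton] at hq
    rcases hq with rfl | rfl | rfl
    · exact mem_filter.2 ⟨ha, hfa⟩
    · exact mem_filter.2 ⟨hb, hfb⟩
    · exact mem_filter.2 ⟨hc, hfc⟩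
  have hcard : ({qa, qb, qc} : Finset ℕ).card = 3 := by
    rw [card_insert_of_notMem (by simp [hab, hac]), card_insert_of_notMem (by simp [hbc]),
      card_singleton]
  have := card_le_card hsub
  rw [hcard, h3 f hf] at this
  omega

end Squares

end Summit.QuantumFields.YangMills.Theorems.HyperbolicToTorus.Negative
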